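import Literature.Analysis.FluidPDE.SteadyNSLiouvillePlanarPotential
import Literature.Analysis.FluidPDE.CylindricalIntegration
import HarnessLib

/-!
# Transfer of cylindrical vorticity decay to the velocity (Wang–Yang 2026, Prop. 4.2): the two
# potential estimates

Analysis/FluidPDE support file (theorems only, no definitions, no named facts) on the discharge
path of the named fact `Literature.Analysis.FluidPDE.wangYang2026_liouville_vorticity_log`
(`SteadyNSLiouville.lean`; W. Wang, G. Yang, arXiv:2608.06040, Theorem 1.6). Proposition 4.2
(pp. 21–22): if `sup_{|x'|=r} |ω| ≤ C r^{-β} L(r)^{-γ}` for `r ≥ 1` (`1 < β < 2`) and `ω ∈ L²`,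
then the Biot–Savart integral `∫ |ω(y)| |x − y|⁻² dy` at a point `x = (x', z)` with
`|x'| = r ≥ 4` is `O(r^{1-β} L(r)^{-γ})`. The printed proof splits `y = (y', k)` into `|y'| ≤ 1`
(the term `I₀`, (4.15): Cauchy–Schwarz with `‖ω‖_{L²}` and `∫_ℝ ds/(a² + s²)² = π/(2a³)`) and
`|y'| > 1` (the term `I₁`, (4.16): `∫_ℝ dk/(a² + (z-k)²) = π/a` and Lemma A.2). This file proves
both estimates for an arbitrary field `ω` on `ℝ³ = EuclideanSpace ℝ (Fin 3)`, in the
cylindrical variables of the tree (`cylSplit : ℝ³ ≃ᵐ ℝ × ℝ²`, `cylRadius`,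
`CylindricalIntegration.lean`), as bounds on lower Lebesgue integrals:

* `lintegral_inv_sq_add_sq` — `∫_ℝ dk/((z-k)² + a²) = π/a` (`a > 0`), and the crude bound
  `∫_ℝ dk/((z-k)² + a²)² ≤ π/a³` (`lintegral_inv_sq_add_sq_sq_le`);
* `norm_sub_sq_eq_cylSplit`, `lintegral_comp_cylSplit` — `|x - y|² = (z-k)² + |x'-y'|²` and
  Tonelli in the variables `(k, y')`;
* `lintegral_far_le_of_cylRadius` — **the term `I₁`**: for `|ω(y)| ≤ A (ρ^β L(ρ)^γ)⁻¹`
  whenever `ρ = cylRadius y > 1`, and `cylRadius x ≥ 2`,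
  `∫_{ρ(y)>1} |x-y|⁻² |ω(y)| dy ≤ A π K · r^{1-β} L(r)^{-γ}` (`r = cylRadius x`, `K` the constant
  of Lemma A.2, `exists_lintegral_planar_logRiesz_le`);
* `lintegral_near_le_of_cylRadius` — **the term `I₀`**: for `cylRadius x ≥ 2`,
  `∫_{ρ(y)≤1} |x-y|⁻² |ω(y)| dy ≤ ‖ω‖_{L²} (8π|B̄₁| r⁻³)^{1/2}`.

## References

* W. Wang, G. Yang, *New decay estimates and Liouville type theorems for the 3D axisymmetric
  stationary Navier–Stokes equations*, arXiv:2608.06040 (2026), Proposition 4.2 and its proof,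
  (4.13)–(4.16), pp. 21–22. [WangYang2026]
-/

noncomputable section

open Real Set MeasureTheory Metric Filter
open scoped ENNReal NNReal Topology

namespace Literature.Analysis.FluidPDE

/-! ### The one-dimensional kernel integrals -/

/-- `k ↦ ((z - k)² + a²)⁻¹` is integrable on `ℝ` for `a > 0` (a dilate and translate of
`(1 + k²)⁻¹`). [folklore] -/
theorem integrable_inv_sq_add_sq {a : ℝ} (ha : 0 < a) (z : ℝ) :
    Integrable fun k : ℝ => ((z - k) ^ 2 + a ^ 2)⁻¹ := by
  have h : Integrable fun k : ℝ => (a ^ 2)⁻¹ * (1 + (a⁻¹ * k) ^ 2)⁻¹ :=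
    (integrable_inv_one_add_sq.comp_mul_left' (inv_ne_zero ha.ne')).const_mul _
  have h' : Integrable fun k : ℝ => (k ^ 2 + a ^ 2)⁻¹ := by
    refine h.congr (ae_of_all _ fun k => ?_)
    have ha2 : a ≠ 0 := ha.ne'
    field_simp
    ring
  have h'' := h'.comp_sub_left z
  exact h''

/-- `∫_ℝ dk/((z-k)² + a²) = π/a` for `a > 0` (Wang–Yang, proof of Prop. 4.2:
"`∫_ℝ dk/(a² + (z-k)²) = π/a, a > 0`"). [cite: WangYang2026, Prop. 4.2 (proof), p. 22] -/
theorem integral_inv_sq_add_sq {a : ℝ} (ha : 0 < a) (z : ℝ) :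
    ∫ k : ℝ, ((z - k) ^ 2 + a ^ 2)⁻¹ = π / a := by
  have h1 : ∫ k : ℝ, ((z - k) ^ 2 + a ^ 2)⁻¹ = ∫ k : ℝ, (k ^ 2 + a ^ 2)⁻¹ :=
    integral_sub_left_eq_self (fun k => (k ^ 2 + a ^ 2)⁻¹) volume z
  have h2 : (fun k : ℝ => (k ^ 2 + a ^ 2)⁻¹) = fun k => (a ^ 2)⁻¹ * (1 + (a⁻¹ * k) ^ 2)⁻¹ := by
    funext k
    have ha2 : a ≠ 0 := ha.ne'
    field_simp
    ring
  rw [h1, h2, integral_const_mul, Measure.integral_comp_inv_mul_left (fun t : ℝ => (1 + t ^ 2)⁻¹) a,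
    integral_univ_inv_one_add_sq, abs_of_pos ha, smul_eq_mul]
  have ha2 : a ≠ 0 := ha.ne'
  field_simp

/-- `ℝ≥0∞` form of `integral_inv_sq_add_sq`. [folklore] -/
theorem lintegral_inv_sq_add_sq {a : ℝ} (ha : 0 < a) (z : ℝ) :
    ∫⁻ k : ℝ, ENNReal.ofReal ((z - k) ^ 2 + a ^ 2)⁻¹ = ENNReal.ofReal (π / a) := by
  rw [← ofReal_integral_eq_lintegral_ofReal (integrable_inv_sq_add_sq ha z)
    (ae_of_all _ fun k => by positivity), integral_inv_sq_add_sq ha z]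

/-- The squared kernel: `∫_ℝ dk/((z-k)² + a²)² ≤ a⁻² · π/a` (pointwise
`((z-k)² + a²)⁻² ≤ a⁻² ((z-k)² + a²)⁻¹`; Wang–Yang use the exact value `π/(2a³)`). [folklore] -/
theorem lintegral_inv_sq_add_sq_sq_le {a : ℝ} (ha : 0 < a) (z : ℝ) :
    ∫⁻ k : ℝ, ENNReal.ofReal (((z - k) ^ 2 + a ^ 2)⁻¹ ^ 2) ≤
      ENNReal.ofReal (a⁻¹ ^ 2) * ENNReal.ofReal (π / a) := by
  rw [← lintegral_inv_sq_add_sq ha z, ← lintegral_const_mul' _ _ ENNReal.ofReal_ne_top]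
  refine lintegral_mono fun k => ?_
  rw [← ENNReal.ofReal_mul (by positivity)]
  refine ENNReal.ofReal_le_ofReal ?_
  rw [sq ((z - k) ^ 2 + a ^ 2)⁻¹, inv_pow]
  refine mul_le_mul_of_nonneg_right (inv_anti₀ (by positivity) ?_) (by positivity)
  nlinarith [sq_nonneg (z - k)]

/-! ### Cylindrical variables -/

/-- `|x - y|² = (z - k)² + |x' - y'|²` in the cylindrical splitting `x ↦ (z, x')`,
`y ↦ (k, y')`. [folklore] -/
theorem norm_sub_sq_eq_cylSplit (x y : EuclideanSpace ℝ (Fin 3)) :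
    ‖x - y‖ ^ 2 = ((cylSplit x).1 - (cylSplit y).1) ^ 2 + ‖(cylSplit x).2 - (cylSplit y).2‖ ^ 2 := by
  have hsq : ∀ v : EuclideanSpace ℝ (Fin 3), ‖v‖ ^ 2 = (v 2) ^ 2 + cylRadius v ^ 2 := fun v => by
    rw [EuclideanSpace.norm_eq, Real.sq_sqrt (Finset.sum_nonneg fun i _ => by positivity),
      Fin.sum_univ_three, cylRadius_sq]
    simp only [Real.norm_eq_abs, sq_abs]
    ring
  have h2 : (cylSplit (x - y)).2 = (cylSplit x).2 - (cylSplit y).2 := by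
    ext j
    simp
  rw [hsq (x - y), cylRadius_eq_norm_cylSplit_snd, h2]
  simp

/-- **Tonelli in cylindrical variables**, `ℝ≥0∞` form: `∫⁻ g(z, x') dx = ∫⁻ dy' ∫⁻ dk g(k, y')`
(`cylSplit` preserves Lebesgue measure). [folklore] -/
theorem lintegral_comp_cylSplit (g : ℝ × EuclideanSpace ℝ (Fin 2) → ℝ≥0∞) (hg : Measurable g) :
    ∫⁻ y : EuclideanSpace ℝ (Fin 3), g (cylSplit y) =
      ∫⁻ w : EuclideanSpace ℝ (Fin 2), ∫⁻ k : ℝ, g (k, w) := by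
  rw [measurePreserving_cylSplit.lintegral_comp_emb cylSplit.measurableEmbedding,
    Measure.volume_eq_prod, lintegral_prod_symm _ hg.aemeasurable]

/-- The far region `{ρ > 1}` is measurable. [folklore] -/
theorem measurableSet_one_lt_cylRadius :
    MeasurableSet {y : EuclideanSpace ℝ (Fin 3) | 1 < cylRadius y} :=
  (isOpen_lt continuous_const continuous_cylRadius).measurableSet

/-- The near region `{ρ ≤ 1}` is measurable. [folklore] -/
theorem measurableSet_cylRadius_le_one :
    MeasurableSet {y : EuclideanSpace ℝ (Fin 3) | cylRadius y ≤ 1} :=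
  (isClosed_le continuous_cylRadius continuous_const).measurableSet

/-- The profile `s ↦ (s^β L(s)^γ)⁻¹`, extended by `0` to `s ≤ 1`, is measurable. [folklore] -/
theorem measurable_indicator_inv_rpow_mul_log_rpow (β γ : ℝ) :
    Measurable fun s : ℝ =>
      (Ioi (1 : ℝ)).indicator (fun s => ENNReal.ofReal (s ^ β * log (exp 1 + s) ^ γ)⁻¹) s :=
  (ENNReal.measurable_ofReal.comp
    ((measurable_id.pow_const β).mul ((measurable_const.add measurable_id).log.pow_const γ)).inv).indicator
    measurableSet_Ioi

/-! ### The term `I₁`: the far region -/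

/-- **Wang–Yang's estimate (4.16)** (the term `I₁` of the proof of Prop. 4.2): let
`1 < β < 2`, `γ > 0`, `A ≥ 0`, and let `K` be a constant of Lemma A.2
(`exists_lintegral_planar_logRiesz_le`). If `|ω(y)| ≤ A (ρ^β L(ρ)^γ)⁻¹` whenever
`ρ = cylRadius y > 1`, then for every `x` with `r = cylRadius x ≥ 2`,
`∫_{ρ(y)>1} |x - y|⁻² |ω(y)| dy ≤ A π K r^{1-β} L(r)^{-γ}`: integrate first in the axial
variable (`∫ dk/((z-k)² + |x'-y'|²) = π/|x'-y'|`), then apply Lemma A.2 in the plane.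
[cite: WangYang2026, Prop. 4.2 (4.16), p. 22] -/
theorem lintegral_far_le_of_cylRadius {β γ A K : ℝ} (hA : 0 ≤ A)
    (hK : ∀ x' : EuclideanSpace ℝ (Fin 2), 2 ≤ ‖x'‖ →
      ∫⁻ w : EuclideanSpace ℝ (Fin 2),
          (Ioi (1 : ℝ)).indicator (fun s => ENNReal.ofReal (s ^ β * log (exp 1 + s) ^ γ)⁻¹) ‖w‖ *
            ENNReal.ofReal ‖x' - w‖⁻¹ ≤
        ENNReal.ofReal (K * (‖x'‖ ^ (1 - β) / log (exp 1 + ‖x'‖) ^ γ)))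
    {ω : EuclideanSpace ℝ (Fin 3) → EuclideanSpace ℝ (Fin 3)}
    (hω : ∀ y, 1 < cylRadius y →
      ‖ω y‖ ≤ A / (cylRadius y ^ β * log (exp 1 + cylRadius y) ^ γ))
    {x : EuclideanSpace ℝ (Fin 3)} (hx : 2 ≤ cylRadius x) :
    ∫⁻ y in {y | 1 < cylRadius y}, ENNReal.ofReal (‖x - y‖ ^ (-(2 : ℝ))) * ‖ω y‖ₑ ≤
      ENNReal.ofReal (A * π * K * (cylRadius x ^ (1 - β) / log (exp 1 + cylRadius x) ^ γ)) := by
  set z : ℝ := (cylSplit x).1 with hz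
  set x' : EuclideanSpace ℝ (Fin 2) := (cylSplit x).2 with hx'
  have hx'r : ‖x'‖ = cylRadius x := (cylRadius_eq_norm_cylSplit_snd x).symm
  set Ψ : ℝ → ℝ≥0∞ := fun s =>
    (Ioi (1 : ℝ)).indicator (fun s => ENNReal.ofReal (s ^ β * log (exp 1 + s) ^ γ)⁻¹) s with hΨ
  have hΨm : Measurable Ψ := measurable_indicator_inv_rpow_mul_log_rpow β γ
  -- the majorant in the variables `(k, w)`
  set G : ℝ × EuclideanSpace ℝ (Fin 2) → ℝ≥0∞ := fun p =>
    ENNReal.ofReal ((z - p.1) ^ 2 + ‖x' - p.2‖ ^ 2)⁻¹ * Ψ ‖p.2‖ with hG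
  have hkm : ∀ w : EuclideanSpace ℝ (Fin 2),
      Measurable fun k : ℝ => ENNReal.ofReal ((z - k) ^ 2 + ‖x' - w‖ ^ 2)⁻¹ := fun w =>
    ENNReal.measurable_ofReal.comp (((measurable_const.sub measurable_id).pow_const 2).add_const _).inv
  have hGm : Measurable G := by
    refine Measurable.mul ?_ (hΨm.comp measurable_snd.norm)
    exact ENNReal.measurable_ofReal.comp
      (((measurable_const.sub measurable_fst).pow_const 2).add
        ((measurable_const.sub measurable_snd).norm.pow_const 2)).inv
  -- (a) pointwise on the far region
  have hpt : ∀ y ∈ {y : EuclideanSpace ℝ (Fin 3) | 1 < cylRadius y},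
      ENNReal.ofReal (‖x - y‖ ^ (-(2 : ℝ))) * ‖ω y‖ₑ ≤ ENNReal.ofReal A * G (cylSplit y) := by
    intro y hy
    have hy' : 1 < cylRadius y := hy
    have hker : ‖x - y‖ ^ (-(2 : ℝ)) = ((z - (cylSplit y).1) ^ 2 + ‖x' - (cylSplit y).2‖ ^ 2)⁻¹ := by
      rw [Real.rpow_neg (norm_nonneg _), Real.rpow_two, norm_sub_sq_eq_cylSplit]
    have hrad : cylRadius y = ‖(cylSplit y).2‖ := cylRadius_eq_norm_cylSplit_snd y
    have hΨy : Ψ ‖(cylSplit y).2‖ =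
        ENNReal.ofReal (cylRadius y ^ β * log (exp 1 + cylRadius y) ^ γ)⁻¹ := by
      rw [hΨ, ← hrad]
      exact indicator_of_mem (mem_Ioi.2 hy') _
    have hωy : ‖ω y‖ ≤ A * (cylRadius y ^ β * log (exp 1 + cylRadius y) ^ γ)⁻¹ := by
      rw [← div_eq_mul_inv]; exact hω y hy'
    calc ENNReal.ofReal (‖x - y‖ ^ (-(2 : ℝ))) * ‖ω y‖ₑ
        = ENNReal.ofReal ((z - (cylSplit y).1) ^ 2 + ‖x' - (cylSplit y).2‖ ^ 2)⁻¹ *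
            ENNReal.ofReal ‖ω y‖ := by rw [hker, ofReal_norm]
      _ ≤ ENNReal.ofReal ((z - (cylSplit y).1) ^ 2 + ‖x' - (cylSplit y).2‖ ^ 2)⁻¹ *
            ENNReal.ofReal (A * (cylRadius y ^ β * log (exp 1 + cylRadius y) ^ γ)⁻¹) :=
          mul_le_mul' le_rfl (ENNReal.ofReal_le_ofReal hωy)
      _ = ENNReal.ofReal A * G (cylSplit y) := by
          rw [ENNReal.ofReal_mul hA, hG]
          dsimp only
          rw [hΨy]
          ring
  -- (b) the axial integration, for a.e. `w`
  have hinner : ∀ᵐ w ∂(volume : Measure (EuclideanSpace ℝ (Fin 2))),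
      ∫⁻ k : ℝ, G (k, w) = Ψ ‖w‖ * ENNReal.ofReal (π * ‖x' - w‖⁻¹) := by
    filter_upwards [Measure.ae_ne volume x'] with w hw
    have ha : 0 < ‖x' - w‖ := norm_pos_iff.2 (sub_ne_zero.2 (Ne.symm hw))
    show ∫⁻ k : ℝ, ENNReal.ofReal ((z - k) ^ 2 + ‖x' - w‖ ^ 2)⁻¹ * Ψ ‖w‖ = _
    rw [lintegral_mul_const _ (hkm w), lintegral_inv_sq_add_sq ha z, mul_comm, div_eq_mul_inv]
  -- (c) assemble
  have hxge : 2 ≤ ‖x'‖ := by rwa [hx'r]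
  calc ∫⁻ y in {y | 1 < cylRadius y}, ENNReal.ofReal (‖x - y‖ ^ (-(2 : ℝ))) * ‖ω y‖ₑ
      ≤ ∫⁻ y in {y | 1 < cylRadius y}, ENNReal.ofReal A * G (cylSplit y) :=
        setLIntegral_mono' measurableSet_one_lt_cylRadius hpt
    _ ≤ ∫⁻ y, ENNReal.ofReal A * G (cylSplit y) := lintegral_mono' Measure.restrict_le_self le_rfl
    _ = ENNReal.ofReal A * ∫⁻ w : EuclideanSpace ℝ (Fin 2), ∫⁻ k : ℝ, G (k, w) := by
        rw [lintegral_const_mul' _ _ ENNReal.ofReal_ne_top, lintegral_comp_cylSplit G hGm]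
    _ = ENNReal.ofReal A * ∫⁻ w : EuclideanSpace ℝ (Fin 2), Ψ ‖w‖ * ENNReal.ofReal (π * ‖x' - w‖⁻¹) := by
        rw [lintegral_congr_ae hinner]
    _ = ENNReal.ofReal A * (ENNReal.ofReal π *
          ∫⁻ w : EuclideanSpace ℝ (Fin 2), Ψ ‖w‖ * ENNReal.ofReal ‖x' - w‖⁻¹) := by
        congr 1
        rw [← lintegral_const_mul' _ _ ENNReal.ofReal_ne_top]
        refine lintegral_congr fun w => ?_
        rw [ENNReal.ofReal_mul pi_pos.le]
        ring
    _ ≤ ENNReal.ofReal A * (ENNReal.ofReal π *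
          ENNReal.ofReal (K * (‖x'‖ ^ (1 - β) / log (exp 1 + ‖x'‖) ^ γ))) := by
        gcongr
        exact hK x' hxge
    _ = ENNReal.ofReal (A * π * K * (cylRadius x ^ (1 - β) / log (exp 1 + cylRadius x) ^ γ)) := by
        rw [hx'r, ← ENNReal.ofReal_mul pi_pos.le, ← ENNReal.ofReal_mul hA]
        ring_nf

/-! ### The term `I₀`: the near region -/

/-- On the near region `{ρ(y) ≤ 1}`, for `r = cylRadius x ≥ 2`, the squared kernel integrates
to at most `8π|B̄₁| r⁻³`: `∫_{ρ(y)≤1} |x-y|⁻⁴ dy ≤ ∫_{|y'|≤1} π/|x'-y'|³ dy'` and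
`|x' - y'| ≥ r - 1 ≥ r/2` there. [cite: WangYang2026, Prop. 4.2 (4.15), p. 22] -/
theorem lintegral_near_kernel_sq_le {x : EuclideanSpace ℝ (Fin 3)} (hx : 2 ≤ cylRadius x) :
    ∫⁻ y in {y | cylRadius y ≤ 1}, ENNReal.ofReal (‖x - y‖ ^ (-(2 : ℝ))) ^ (2 : ℝ) ≤
      ENNReal.ofReal (8 * π * (cylRadius x)⁻¹ ^ 3) *
        volume (closedBall (0 : EuclideanSpace ℝ (Fin 2)) 1) := by
  set z : ℝ := (cylSplit x).1 with hz
  set x' : EuclideanSpace ℝ (Fin 2) := (cylSplit x).2 with hx'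
  have hx'r : ‖x'‖ = cylRadius x := (cylRadius_eq_norm_cylSplit_snd x).symm
  set r := cylRadius x with hr
  have hr0 : 0 < r := by linarith
  -- the majorant in the variables `(k, w)`
  set H : ℝ × EuclideanSpace ℝ (Fin 2) → ℝ≥0∞ := fun p =>
    (closedBall (0 : EuclideanSpace ℝ (Fin 2)) 1).indicator
      (fun w => ENNReal.ofReal (((z - p.1) ^ 2 + ‖x' - w‖ ^ 2)⁻¹ ^ 2)) p.2 with hH
  have hkm : ∀ w : EuclideanSpace ℝ (Fin 2),
      Measurable fun k : ℝ => ENNReal.ofReal (((z - k) ^ 2 + ‖x' - w‖ ^ 2)⁻¹ ^ 2) := fun w =>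
    ENNReal.measurable_ofReal.comp
      ((((measurable_const.sub measurable_id).pow_const 2).add_const _).inv.pow_const 2)
  have hHm : Measurable H := by
    have h1 : Measurable fun p : ℝ × EuclideanSpace ℝ (Fin 2) =>
        ENNReal.ofReal (((z - p.1) ^ 2 + ‖x' - p.2‖ ^ 2)⁻¹ ^ 2) :=
      ENNReal.measurable_ofReal.comp
        ((((measurable_const.sub measurable_fst).pow_const 2).add
          ((measurable_const.sub measurable_snd).norm.pow_const 2)).inv.pow_const 2)
    have h2 : H = (Prod.snd ⁻¹' closedBall (0 : EuclideanSpace ℝ (Fin 2)) 1).indicator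
        (fun p : ℝ × EuclideanSpace ℝ (Fin 2) =>
          ENNReal.ofReal (((z - p.1) ^ 2 + ‖x' - p.2‖ ^ 2)⁻¹ ^ 2)) := by
      funext p
      rw [hH]
      dsimp only
      by_cases hp : p.2 ∈ closedBall (0 : EuclideanSpace ℝ (Fin 2)) 1
      · have hp' : p ∈ Prod.snd ⁻¹' closedBall (0 : EuclideanSpace ℝ (Fin 2)) 1 := hp
        rw [indicator_of_mem hp, indicator_of_mem hp']
      · have hp' : p ∉ Prod.snd ⁻¹' closedBall (0 : EuclideanSpace ℝ (Fin 2)) 1 := hp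
        rw [indicator_of_notMem hp, indicator_of_notMem hp']
    rw [h2]
    exact h1.indicator (measurable_snd measurableSet_closedBall)
  -- (a) pointwise on the near region
  have hpt : ∀ y ∈ {y : EuclideanSpace ℝ (Fin 3) | cylRadius y ≤ 1},
      ENNReal.ofReal (‖x - y‖ ^ (-(2 : ℝ))) ^ (2 : ℝ) ≤ H (cylSplit y) := by
    intro y hy
    have hy' : cylRadius y ≤ 1 := hy
    have hmem : (cylSplit y).2 ∈ closedBall (0 : EuclideanSpace ℝ (Fin 2)) 1 := by
      rw [mem_closedBall, dist_zero_right, ← cylRadius_eq_norm_cylSplit_snd]; exact hy'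
    have hker : ‖x - y‖ ^ (-(2 : ℝ)) = ((z - (cylSplit y).1) ^ 2 + ‖x' - (cylSplit y).2‖ ^ 2)⁻¹ := by
      rw [Real.rpow_neg (norm_nonneg _), Real.rpow_two, norm_sub_sq_eq_cylSplit]
    rw [hH]
    dsimp only
    rw [indicator_of_mem hmem, hker, ENNReal.ofReal_rpow_of_nonneg (by positivity) zero_le_two,
      Real.rpow_two]
  -- (b) the axial integration on the disc
  have hinner : ∀ w ∈ closedBall (0 : EuclideanSpace ℝ (Fin 2)) 1,
      ∫⁻ k : ℝ, ENNReal.ofReal (((z - k) ^ 2 + ‖x' - w‖ ^ 2)⁻¹ ^ 2) ≤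
        ENNReal.ofReal (8 * π * r⁻¹ ^ 3) := by
    intro w hw
    rw [mem_closedBall, dist_zero_right] at hw
    have ha : r / 2 ≤ ‖x' - w‖ := by
      have := norm_sub_norm_le x' w
      rw [hx'r] at this
      linarith
    have ha0 : 0 < ‖x' - w‖ := by linarith
    calc ∫⁻ k : ℝ, ENNReal.ofReal (((z - k) ^ 2 + ‖x' - w‖ ^ 2)⁻¹ ^ 2)
        ≤ ENNReal.ofReal (‖x' - w‖⁻¹ ^ 2) * ENNReal.ofReal (π / ‖x' - w‖) :=
          lintegral_inv_sq_add_sq_sq_le ha0 z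
      _ = ENNReal.ofReal (π * ‖x' - w‖⁻¹ ^ 3) := by
          rw [← ENNReal.ofReal_mul (by positivity)]
          congr 1
          rw [div_eq_mul_inv]
          ring
      _ ≤ ENNReal.ofReal (8 * π * r⁻¹ ^ 3) := by
          refine ENNReal.ofReal_le_ofReal ?_
          have hinv : ‖x' - w‖⁻¹ ≤ 2 * r⁻¹ := by
            rw [show 2 * r⁻¹ = (r / 2)⁻¹ by rw [inv_div]; ring]
            exact inv_anti₀ (by positivity) ha
          have h3 : ‖x' - w‖⁻¹ ^ 3 ≤ (2 * r⁻¹) ^ 3 :=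
            pow_le_pow_left₀ (by positivity) hinv 3
          nlinarith [pi_pos, h3]
  -- (c) assemble
  calc ∫⁻ y in {y | cylRadius y ≤ 1}, ENNReal.ofReal (‖x - y‖ ^ (-(2 : ℝ))) ^ (2 : ℝ)
      ≤ ∫⁻ y in {y | cylRadius y ≤ 1}, H (cylSplit y) :=
        setLIntegral_mono' measurableSet_cylRadius_le_one hpt
    _ ≤ ∫⁻ y, H (cylSplit y) := lintegral_mono' Measure.restrict_le_self le_rfl
    _ = ∫⁻ w : EuclideanSpace ℝ (Fin 2), ∫⁻ k : ℝ, H (k, w) := lintegral_comp_cylSplit H hHm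
    _ = ∫⁻ w : EuclideanSpace ℝ (Fin 2), (closedBall (0 : EuclideanSpace ℝ (Fin 2)) 1).indicator
          (fun w => ∫⁻ k : ℝ, ENNReal.ofReal (((z - k) ^ 2 + ‖x' - w‖ ^ 2)⁻¹ ^ 2)) w := by
        refine lintegral_congr fun w => ?_
        by_cases hw : w ∈ closedBall (0 : EuclideanSpace ℝ (Fin 2)) 1
        · rw [indicator_of_mem hw]
          refine lintegral_congr fun k => ?_
          rw [hH]
          dsimp only
          rw [indicator_of_mem hw]
        · rw [indicator_of_notMem hw]
          have : (fun k : ℝ => H (k, w)) = fun _ => 0 := by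
            funext k
            rw [hH]
            dsimp only
            rw [indicator_of_notMem hw]
          rw [this, lintegral_zero]
    _ = ∫⁻ w in closedBall (0 : EuclideanSpace ℝ (Fin 2)) 1,
          ∫⁻ k : ℝ, ENNReal.ofReal (((z - k) ^ 2 + ‖x' - w‖ ^ 2)⁻¹ ^ 2) :=
        lintegral_indicator measurableSet_closedBall _
    _ ≤ ∫⁻ w in closedBall (0 : EuclideanSpace ℝ (Fin 2)) 1, ENNReal.ofReal (8 * π * r⁻¹ ^ 3) :=
        setLIntegral_mono' measurableSet_closedBall hinner
    _ = ENNReal.ofReal (8 * π * r⁻¹ ^ 3) * volume (closedBall (0 : EuclideanSpace ℝ (Fin 2)) 1) :=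
        setLIntegral_const _ _

/-- **Wang–Yang's estimate (4.15)** (the term `I₀` of the proof of Prop. 4.2): for any field `ω`
with measurable norm and every `x` with `r = cylRadius x ≥ 2`,
`∫_{ρ(y)≤1} |x-y|⁻² |ω(y)| dy ≤ ‖ω‖_{L²} · (8π|B̄₁| r⁻³)^{1/2}` (Cauchy–Schwarz and the previous
kernel bound; in print `≤ C r^{-3/2}` with `C` depending on `‖ω‖_{L²}`).
[cite: WangYang2026, Prop. 4.2 (4.15), p. 22] -/
theorem lintegral_near_le_of_cylRadius {ω : EuclideanSpace ℝ (Fin 3) → EuclideanSpace ℝ (Fin 3)}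
    (hωm : Measurable fun y => ‖ω y‖ₑ) {x : EuclideanSpace ℝ (Fin 3)} (hx : 2 ≤ cylRadius x) :
    ∫⁻ y in {y | cylRadius y ≤ 1}, ENNReal.ofReal (‖x - y‖ ^ (-(2 : ℝ))) * ‖ω y‖ₑ ≤
      (∫⁻ y, ‖ω y‖ₑ ^ (2 : ℝ)) ^ (1 / 2 : ℝ) *
        (ENNReal.ofReal (8 * π * (cylRadius x)⁻¹ ^ 3) *
          volume (closedBall (0 : EuclideanSpace ℝ (Fin 2)) 1)) ^ (1 / 2 : ℝ) := by
  have hkm : Measurable fun y : EuclideanSpace ℝ (Fin 3) => ENNReal.ofReal (‖x - y‖ ^ (-(2 : ℝ))) :=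
    ENNReal.measurable_ofReal.comp ((measurable_const.sub measurable_id).norm.pow_const _)
  have hH := ENNReal.lintegral_mul_le_Lp_mul_Lq (volume.restrict {y | cylRadius y ≤ 1})
    Real.HolderConjugate.two_two hωm.aemeasurable hkm.aemeasurable
  calc ∫⁻ y in {y | cylRadius y ≤ 1}, ENNReal.ofReal (‖x - y‖ ^ (-(2 : ℝ))) * ‖ω y‖ₑ
      = ∫⁻ y in {y | cylRadius y ≤ 1},
          ((fun y => ‖ω y‖ₑ) * fun y => ENNReal.ofReal (‖x - y‖ ^ (-(2 : ℝ)))) y := by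
        refine lintegral_congr fun y => ?_
        rw [Pi.mul_apply, mul_comm]
    _ ≤ (∫⁻ y in {y | cylRadius y ≤ 1}, ‖ω y‖ₑ ^ (2 : ℝ)) ^ (1 / 2 : ℝ) *
          (∫⁻ y in {y | cylRadius y ≤ 1}, ENNReal.ofReal (‖x - y‖ ^ (-(2 : ℝ))) ^ (2 : ℝ)) ^ (1 / 2 : ℝ) := hH
    _ ≤ (∫⁻ y, ‖ω y‖ₑ ^ (2 : ℝ)) ^ (1 / 2 : ℝ) *
          (ENNReal.ofReal (8 * π * (cylRadius x)⁻¹ ^ 3) *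
            volume (closedBall (0 : EuclideanSpace ℝ (Fin 2)) 1)) ^ (1 / 2 : ℝ) := by
        gcongr
        · exact Measure.restrict_le_self
        · exact lintegral_near_kernel_sq_le hx

end Literature.Analysis.FluidPDE

end
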